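import Summits.AtomisticToContinuum.Crystallization.Theorems.OverbindingBudgetUniformCutStatements
import Summits.AtomisticToContinuum.Crystallization.Theorems.ShellCensus.Negative.TornIcosahedron

/-!
# `SlackKissingRigidity T₀ (1/5)` is FALSE for every `T₀ ≥ 0` (decomp-a2c lens-4, gen 25, rev b)

`OverbindingBudgetUniformCutStatements.SlackKissingRigidity T₀ ρ` (p811146) is the single-shell
«slack Fejes Tóth–Hales» statement used in the cut `liouU_of_kissing_strain :
SlackKissingRigidity T₀ ρ → BarlowStrainExclusion T₀ ρ D → CleanLiouvilleU T₀ D`.  At `ρ = 1/5` it is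
refuted BY THE TREE: the torn-icosahedron gapped twelve-shell
`ShellCensusNegative.T` (`Theorems/ShellCensus/Negative/TornIcosahedron.lean`, the witness that
refuted `GappedShellCensus.ShellCensus`, stmt-AtomisticToContinuum-15929) satisfies the hypotheses of
`SlackKissingRigidity T₀ (1/5)` at spacing `a = 1`, centre `y = 0` (its norms lie in
`[49/50, 51/50]`, its pair distances in `[49/50, 51/50] ∪ [63/50, ∞)`, and `T₀ ≥ 0` only loosens the
window), while `not_close_fcc` / `not_close_hcp` say it is not `1/5`-close to either kissing pattern.
Hence the finite factor of that cut is false and the cut is vacuous as a line (the implication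
stays true).  Independent numerical witnesses with 20–23 bonds, certified `> 1/5` (indeed `> 0.215`)
from both patterns under every isometry, are recorded in the seat's evidence
(`num/KR-REFUTATION.md` on stmt-AtomisticToContinuum-31280).

Main results: `not_slackKissingRigidity : 0 ≤ T₀ → ¬ SlackKissingRigidity T₀ (1/5)`,
`not_slackKissingRigidity_record : ¬ SlackKissingRigidity (1/250) (1/5)`.
-/

namespace Summit.AtomisticToContinuum.Crystallization.Theorems.OverbindingBudgetUniformCutNegative

open Literature.Geometry.DiscreteGeometry (ShellCloseTo fccKissingPattern hcpKissingPattern)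
open Summit.AtomisticToContinuum.Crystallization.Theorems.OverbindingBudgetUniformCutStatements (SlackKissingRigidity)
open Summit.AtomisticToContinuum.Crystallization.Theorems.ShellCensusNegative (T T_card T_norm T_dist not_close_fcc not_close_hcp)

local notation "E" => EuclideanSpace ℝ (Fin 3)

/-- **`SlackKissingRigidity T₀ (1/5)` fails for every `T₀ ≥ 0`**: the torn icosahedron
`ShellCensusNegative.T` is an admissible instance (`a = 1`, `y = 0`) that is `1/5`-close to neither
kissing pattern. [folklore; this file, from `ShellCensusNegative.not_close_fcc/hcp`] -/
theorem not_slackKissingRigidity {T₀ : ℝ} (hT₀ : 0 ≤ T₀) : ¬ SlackKissingRigidity T₀ (1 / 5) := by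
  intro h
  have hnorm : ∀ w ∈ T, 1 * (1 - 1 / 50) - T₀ ≤ dist (0 : E) w ∧ dist (0 : E) w ≤ 1 * (1 + 1 / 50) + T₀ := by
    intro w hw
    have h1 := T_norm w hw
    rw [dist_comm, dist_zero_right]
    constructor <;> linarith [h1.1, h1.2]
  have hdist : ∀ w ∈ T, ∀ w' ∈ T, w ≠ w' →
      1 * (1 - 1 / 50) - T₀ ≤ dist w w' ∧ (dist w w' ≤ 1 * (1 + 1 / 50) + T₀ ∨ 1 * (63 / 50) - T₀ ≤ dist w w') := by
    intro w hw w' hw' hne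
    have h1 := T_dist w hw w' hw' hne
    refine ⟨by linarith [h1.1], ?_⟩
    rcases h1.2 with h2 | h2
    · exact Or.inl (by linarith)
    · exact Or.inr (by linarith)
  obtain ⟨T', hT', hclose⟩ := h 1 (by norm_num) le_rfl (0 : E) T T_card hnorm hdist
  have himg : (fun w : E => (1 : ℝ)⁻¹ • (w - 0)) '' (↑T : Set E) = ↑T := by
    have hid : (fun w : E => (1 : ℝ)⁻¹ • (w - 0)) = id := by
      funext w; simp
    rw [hid, Set.image_id]
  have hTT : T' = T := Finset.coe_inj.1 (hT'.trans himg)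
  subst hTT
  rcases hclose with hc | hc
  · exact not_close_fcc hc
  · exact not_close_hcp hc

/-- The numerals of record of node UniformCut: `SlackKissingRigidity (1/250) (1/5)` is false. [folklore; this file] -/
theorem not_slackKissingRigidity_record : ¬ SlackKissingRigidity (1 / 250) (1 / 5) :=
  not_slackKissingRigidity (by norm_num)

/-- Also at zero extra slack (the pure `2 %` window of the relaxed gapped-twelve test). [folklore; this file] -/
theorem not_slackKissingRigidity_zero : ¬ SlackKissingRigidity 0 (1 / 5) :=
  not_slackKissingRigidity le_rfl

end Summit.AtomisticToContinuum.Crystallization.Theorems.OverbindingBudgetUniformCutNegative
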